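import Literature.IUT.HodgeTheaters.PiAvatarOrbitCategoryProofs
import Literature.IUT.HodgeTheaters.InitialThetaDataLocalGroupsOpenProofs
import HarnessLib

/-!
# The genuine global Π-avatar object: `Π_{X̲_K} ⊴ Π_{C̲_K}` of index two inside `Π_{C_F}`, and the `±`-involution of
# `𝒟^{⊚±} = ℬ(X̲_K)⁰ → 𝒟^⊚ = ℬ(C̲_K)⁰` AT THE INITIAL Θ-DATA (proof-only; first instance-level theorems of KIT-INSTANCE-SPEC P5)

S. Mochizuki, *Inter-universal Teichmüller theory I*, kurims manuscript (May 2020), Def 3.1 (d) p. 62 ("`C̲_K` is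
a hyperbolic orbicurve of type `(1,l-tors)_±` … with `K`-core `C_K := C_F ×_F K` … determines, up to
`K`-isomorphism, a hyperbolic orbicurve `X̲_K` of type `(1,l-tors)` … natural cartesian diagrams `X̲_K → X_K`,
`C̲_K → C_K`"), Def 4.1 (v) p. 97 (`𝒟^⊚ := ℬ(C̲_K)⁰`), Def 6.1 (v) p. 158 ("`𝒟^{⊚±} := ℬ(X̲_K)⁰` … a finite
étale double covering `𝒟^{⊚±} → 𝒟^⊚ = ℬ(C̲_K)⁰`"; "`Aut_K(X̲_K) ⥲ Aut_±(𝒟^{⊚±})/Aut_csp(𝒟^{⊚±}) ⥲ 𝔽_l^{⋊±}`") ([IUTchI] Def 6.1 (v) p.158) [claim: Mochizuki2012, status: disputed]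
(D-0012 claim key, series status DISPUTED — instance-level plumbing; nothing of the series is asserted, no side
taken on [IUTchIII] Cor. 3.12).

DESIGN (L5-lead RULINGS #17 (2): D1 = EMBEDDED; abc-iut-L5-t4 KIT-INSTANCE-SPEC P5): the ambient group is
`A := Π_{C_F}` = abc-iut-L5-t2's `D.PiC = D.geom.extF.arith` (`InitialThetaData.geom : ThetaGeometry`), and the global
model object `𝒟^{⊚±}` is the embedded connected object of abc-iut-L5-t2's subgroup
`D.PiXund = (D.geom.pe.PiXbar).map D.geom.embK` = `Π_{X̲_K}` (abc-iut-L5-t1's `PuncturedEllipticData` at `K` encodes the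
type-`(1,l-tors)` curve `X̲_K` of Def 3.1 (d) as `X̲ = X ×_C C̲`, `PiXbar = PiX ⊓ PiCbar`, and `C̲_K` (type `(1,l-tors)_±`)
as `C̲`, `PiCbar`; `D.PiCund = (D.geom.pe.PiCbar).map D.geom.embK` = `Π_{C̲_K}`), embedded into `Π_{C_F}` by `embK`
(injective, range `D.PiCK = Π_{C_K}`).  No new definition is introduced here (the binding DEFINITIONS `Amb v`, `Glob`,
`gModel`, … are the next defs-window file); the theorems are stated over abc-iut-L5-t2's subgroups.

* (`Π_{X̲_K} ≤ Π_{C̲_K}` is abc-iut-L5-t2's `InitialThetaData.PiXund_le_PiCund`, reused) `piXund_relIndex_piCund : relIndex = 2` (transport of t1/t2's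
  `PiXbar_relIndex_PiCbar` along the injective `embK`);
* `InitialThetaData.piCund_le_normalizer_piXund` — `Π_{C̲_K}` normalises `Π_{X̲_K}` in `Π_{C_F}` (index two);
* `InitialThetaData.exists_globalInvolution` — there is `a ∈ Π_{C̲_K} \ Π_{X̲_K}` inducing a NON-TRIVIAL INVOLUTIVE
  automorphism of the object `ℬ(X̲_K)⁰` of the orbit category of `Π_{C_F}`: the deck involution of the double covering
  `𝒟^{⊚±} → 𝒟^⊚` of Def 6.1 (v), i.e. the `{±1} ⊆ 𝔽_l^{⋊±} ≅ Aut_K(X̲_K)` part of `Aut(𝒟^{⊚±})`, AT THE GENUINE DATA.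

typed ≠ proved elsewhere; every `theorem` below is kernel-checked over abc-iut-L5-t2's REAL `InitialThetaData`.
-/

namespace Literature.IUT.HodgeTheaters

open CategoryTheory

universe u v w

section Global

variable {F : Type u} {K : Type v} {Fbar : Type w} [Field F] [NumberField F] [Field K]
  [NumberField K] [Algebra F K] [Field Fbar] [Algebra F Fbar] [Algebra K Fbar]
  {E : WeierstrassCurve F} [E.IsElliptic] {l : ℕ} {P : BadPlacePredicates K}
  (D : InitialThetaData F K Fbar E l P)

namespace InitialThetaData

/-- `[Π_{C̲_K} : Π_{X̲_K}] = 2` inside `Π_{C_F}` (Def 6.1 (v): "a finite étale double covering `𝒟^{⊚±} → 𝒟^⊚ = ℬ(C̲_K)⁰`";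
t2's `ThetaGeometry.PiXbar_relIndex_PiCbar` transported along the injective `embK`).
([IUTchI] Def 6.1 (v) p.158) [claim: Mochizuki2012, status: disputed] -/
theorem piXund_relIndex_piCund : D.PiXund.relIndex D.PiCund = 2 := by
  rw [InitialThetaData.PiXund, InitialThetaData.PiCund,
    Subgroup.relIndex_map_map_of_injective _ _ D.geom.embK_injective]
  exact D.geom.PiXbar_relIndex_PiCbar

/-- `Π_{C̲_K}` normalises `Π_{X̲_K}` in `Π_{C_F}` (index two ⇒ normal): every element of `Π_{C̲_K}` induces an
automorphism of `𝒟^{⊚±} = ℬ(X̲_K)⁰` (`OrbitCat.autOfNormalizer`). ([IUTchI] Def 6.1 (v) p.158) [claim: Mochizuki2012, status: disputed] -/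
theorem piCund_le_normalizer_piXund :
    D.PiCund ≤ Subgroup.normalizer ((D.PiXund : Subgroup D.PiC) : Set D.PiC) :=
  OrbitCat.le_normalizer_of_relIndex_eq_two D.PiXund_le_PiCund D.piXund_relIndex_piCund

/-- **The `±`-involution of `𝒟^{⊚±}` at the genuine initial Θ-data.** In the orbit category of `Π_{C_F}` (the
Π-avatar of `ℬ(C_F)⁰` with embedded objects) the object `ℬ(X̲_K)⁰` carries an automorphism induced by an element of
`Π_{C̲_K} \ Π_{X̲_K}` which is NOT the identity and SQUARES to the identity — the deck transformation of the double
covering `𝒟^{⊚±} → 𝒟^⊚` of Def 6.1 (v) (the `{±1}` of `𝔽_l^{⋊±} ≅ Aut_K(X̲_K)`).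
([IUTchI] Def 6.1 (v) p.158) [claim: Mochizuki2012, status: disputed] -/
theorem exists_globalInvolution :
    ∃ (a : D.PiC) (ha : a ∈ Subgroup.normalizer ((D.PiXund : Subgroup D.PiC) : Set D.PiC)),
      a ∈ D.PiCund ∧ a ∉ D.PiXund ∧
      OrbitCat.autOfNormalizer a ha ≠ Iso.refl (OrbitCat.of D.PiXund) ∧
      OrbitCat.autOfNormalizer a ha ≪≫ OrbitCat.autOfNormalizer a ha = Iso.refl (OrbitCat.of D.PiXund) :=
  OrbitCat.exists_involution_of_relIndex_eq_two D.PiXund_le_PiCund D.piXund_relIndex_piCund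

end InitialThetaData

end Global

end Literature.IUT.HodgeTheaters
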